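import Literature.MathematicalPhysics.QuantumManyBody.PeriodicConfigFourier
import Literature.MathematicalPhysics.QuantumManyBody.TorusAutocorrelationKernel
import HarnessLib

/-!
# Route `BECSubharmonicContinuation`, support `CoreDeficitBounds` (stmt-AtomisticToContinuum-9004) —
# helper: the Fourier representation of the translation and gradient correlations

For a periodic trial state `Ψ` of `N` bosons on the torus of side `L`, a particle `i` and `y ∈ ℝ³`,
the translation correlation `G(y) = Re ∫_{cell^N} conj Ψ(X with xᵢ ↦ xᵢ + y) Ψ(X) dX` and the
gradient correlation `H(y) = Re ∑ₖ ∫ conj ∂_{i,k}Ψ(X with xᵢ ↦ xᵢ + y) ∂_{i,k}Ψ(X) dX` are the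
absolutely convergent cosine series

`G(y) = ∑ₙ aₙ cos(κₙ·y)`, `H(y) = ∑ₙ |κₙ|² aₙ cos(κₙ·y)`, `∑ₙ aₙ = 1`,

over `n ∈ ℤ^{3N}`, with `aₙ = L^{3N} |ĉₙ(Ψ)|² ≥ 0` (the `3N`-torus Fourier coefficients of
`PeriodicConfigFourier`) and `κₙ = (2π/L) n(i,·) ∈ ℝ³` (`hasSum_translationCorrelation`,
`hasSum_gradientCorrelation`, `hasSum_coeff`). Proof: polarised Parseval on `(ℝ/ℤ)^{3N}`
(`hasSum_conj_mFourierCoeff_mul` of `TorusAutocorrelationKernel`), the translation rule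
`ĉₙ(Ψ(· + eᵢ ⊗ y)) = e^{2πi n(i,·)·y/L} ĉₙ(Ψ)` and the derivative rule
`ĉₙ(∂_{i,k}Ψ) = (2πi n(i,k)/L) ĉₙ(Ψ)` of `PeriodicConfigFourier`; no positivity of the one-body
density matrix and no particle slicing is used (the mode sum runs over `ℤ^{3N}`).
-/

noncomputable section

open MeasureTheory Set Filter Complex UnitAddTorus
open scoped ENNReal NNReal Topology ComplexConjugate BigOperators

namespace Summit.AtomisticToContinuum.BoseEinsteinCondensation.Theorems.CoreDeficitBounds

open Literature.MathematicalPhysics.QuantumManyBody.BoseGas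

-- The measure on `ℝ/ℤ` is the Haar probability measure: the LOCAL instances of
-- `PeriodicConfigFourier.lean` (definitionally those of `Mathlib.Analysis.Fourier.AddCircleMulti`),
-- re-activated locally; nothing is declared.
attribute [local instance] configFourier_measureSpace configFourier_isProbabilityMeasure
  configFourier_isProbabilityMeasure_pi configFourier_isAddLeftInvariant
  configFourier_isAddLeftInvariant_pi

variable {N : ℕ} {L : ℝ}

/-- **The character at a one-particle translation**: for `n ∈ ℤ^{3N}` and `y ∈ ℝ³`,
`e_n((eᵢ ⊗ y)/L mod 1) = exp(2πi ∑ₖ n(i,k) yₖ / L)`. -/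
theorem mFourier_toUnitTorusN_single (L : ℝ) (n : Fin N × Fin 3 → ℤ) (i : Fin N) (y : Space) :
    mFourier n (toUnitTorusN L (Pi.single i y : Config N)) =
      Complex.exp ((∑ k, 2 * Real.pi * (n (i, k) : ℝ) * y k / L : ℝ) * I) := by
  classical
  simp only [mFourier, ContinuousMap.coe_mk]
  rw [Fintype.prod_prod_type, Finset.prod_eq_single i]
  · have hk : ∀ k : Fin 3, fourier (n (i, k)) (toUnitTorusN L (Pi.single i y : Config N) (i, k)) =
        Complex.exp ((2 * Real.pi * (n (i, k) : ℝ) * y k / L : ℝ) * I) := by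
      intro k
      rw [toUnitTorusN_apply, fourier_coe_apply]
      simp only [Pi.single_eq_same]
      congr 1
      push_cast
      ring
    simp_rw [hk, ← Complex.exp_sum]
    congr 1
    push_cast
    rw [Finset.sum_mul]
  · intro j _ hj
    refine Finset.prod_eq_one fun k _ => ?_
    rw [toUnitTorusN_apply]
    simp [Pi.single_eq_of_ne hj]
  · intro h; exact absurd (Finset.mem_univ i) h

/-- The real part of `a · conj(e^{iθ}) · b` for real `a` and `b` of vanishing imaginary part is
`a · Re b · cos θ`. -/
theorem re_ofReal_mul_conj_cexp_mul (a θ : ℝ) (b : ℂ) (hb : b.im = 0) :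
    ((a : ℂ) * (conj (Complex.exp (θ * I)) * b)).re = a * b.re * Real.cos θ := by
  simp only [Complex.mul_re, Complex.mul_im, Complex.conj_re, Complex.conj_im, Complex.ofReal_re,
    Complex.ofReal_im, Complex.exp_ofReal_mul_I_re, Complex.exp_ofReal_mul_I_im, hb]
  ring

/-- **The correlation of a periodic function with its one-particle translate, in momentum space.**
For `f` continuous and `Lℤ³`-periodic in every particle, `i` a particle and `y ∈ ℝ³`,
`Re ∫_{cell^N} conj f(X with xᵢ ↦ xᵢ + y) f(X) dX = ∑ₙ L^{3N}|ĉₙ(f)|² cos(2π n(i,·)·y / L)`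
(absolutely convergent; polarised Parseval and the translation rule on `(ℝ/ℤ)^{3N}`). -/
theorem hasSum_correlation (hL : 0 < L) {f : Config N → ℂ} (hf : Continuous f)
    (hper : IsTorusPeriodic L f) (i : Fin N) (y : Space) :
    HasSum (fun n : Fin N × Fin 3 → ℤ => (L ^ 3) ^ N * ‖configFourierCoeff L f n‖ ^ 2 *
        Real.cos (∑ k, 2 * Real.pi * (n (i, k) : ℝ) * y k / L))
      (∫ X in cellN N L, conj (f (Function.update X i (X i + y))) * f X).re := by
  set Hv : Config N := Pi.single i y with hHv
  set fH : Config N → ℂ := fun X => f (X + Hv) with hfH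
  have hfHc : Continuous fH := hf.comp (continuous_id.add continuous_const)
  -- polarised Parseval on the torus
  have hP := hasSum_conj_mFourierCoeff_mul (memLp_torusFunN hL hfHc) (memLp_torusFunN hL hf)
  -- the coefficients
  have hcoef : ∀ n, conj (mFourierCoeff (torusFunN L fH) n) * mFourierCoeff (torusFunN L f) n =
      conj (mFourier n (toUnitTorusN L Hv)) * ((‖configFourierCoeff L f n‖ : ℂ) ^ 2) := by
    intro n
    show conj (configFourierCoeff L fH n) * configFourierCoeff L f n = _
    rw [hfH, configFourierCoeff_translate hL hper Hv n, map_mul, mul_assoc, Complex.conj_mul']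
  -- the integral
  have hmeas : AEStronglyMeasurable (fun X => conj (f (X + Hv)) * f X)
      (volume.restrict (cellN N L)) :=
    ((Complex.continuous_conj.comp hfHc).mul hf).aestronglyMeasurable
  have hint : ∫ t, conj (torusFunN L fH t) * torusFunN L f t =
      ((((L ^ 3)⁻¹) ^ N : ℝ)) • ∫ X in cellN N L, conj (f (X + Hv)) * f X :=
    integral_fromUnitTorusN hL hmeas
  rw [hint] at hP
  simp_rw [hcoef] at hP
  -- clear the normalisation `L^{-3N}` and take real parts
  have hL3 : ((L ^ 3) ^ N : ℝ) ≠ 0 := by positivity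
  have hP2 := hP.mul_left (((L ^ 3) ^ N : ℝ) : ℂ)
  have hval : (((L ^ 3) ^ N : ℝ) : ℂ) * ((((L ^ 3)⁻¹) ^ N : ℝ) • ∫ X in cellN N L, conj (f (X + Hv)) * f X)
      = ∫ X in cellN N L, conj (f (X + Hv)) * f X := by
    rw [Complex.real_smul, ← mul_assoc, ← Complex.ofReal_mul, inv_pow, mul_inv_cancel₀ hL3,
      Complex.ofReal_one, one_mul]
  rw [hval] at hP2
  have hP3 := Complex.reCLM.hasSum hP2
  simp only [Complex.reCLM_apply] at hP3
  -- identify the terms and the value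
  have hterm : ∀ n : Fin N × Fin 3 → ℤ,
      ((((L ^ 3) ^ N : ℝ) : ℂ) * (conj (mFourier n (toUnitTorusN L Hv)) *
        ((‖configFourierCoeff L f n‖ : ℂ) ^ 2))).re =
      (L ^ 3) ^ N * ‖configFourierCoeff L f n‖ ^ 2 *
        Real.cos (∑ k, 2 * Real.pi * (n (i, k) : ℝ) * y k / L) := by
    intro n
    rw [hHv, mFourier_toUnitTorusN_single, ← Complex.ofReal_pow,
      re_ofReal_mul_conj_cexp_mul _ _ _ (Complex.ofReal_im _), Complex.ofReal_re]
  simp_rw [hterm] at hP3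
  have hupd : (fun X : Config N => conj (f (Function.update X i (X i + y))) * f X) =
      fun X => conj (f (X + Hv)) * f X := by
    funext X; rw [update_eq_add_single]
  rw [hupd]
  exact hP3

/-- **The squared mass of the Fourier coefficients of a trial state**:
`∑ₙ L^{3N} |ĉₙ(Ψ)|² = 1` (Parseval and the normalisation `∫_{cell^N}|Ψ|² = 1`). -/
theorem hasSum_coeff (hL : 0 < L) (Ψ : PeriodicTrialState N L) :
    HasSum (fun n : Fin N × Fin 3 → ℤ => (L ^ 3) ^ N * ‖configFourierCoeff L Ψ.ψ n‖ ^ 2) 1 := by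
  have hc : Continuous Ψ.ψ := Ψ.contDiff.continuous
  have hP := (hasSum_sq_configFourierCoeff hL hc).mul_left ((L ^ 3) ^ N)
  have hM : ∫ X in cellN N L, ‖Ψ.ψ X‖ ^ 2 = 1 := by
    have h1 : ∫⁻ X in cellN N L, (‖Ψ.ψ X‖₊ : ℝ≥0∞) ^ 2 =
        ENNReal.ofReal (∫ X in cellN N L, ‖Ψ.ψ X‖ ^ 2) := by
      rw [ofReal_integral_eq_lintegral_ofReal (integrableOn_sq_cellN L hc)
        (ae_of_all _ fun X => sq_nonneg _)]
      exact lintegral_congr fun X => coe_nnnorm_sq_eq_ofReal _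
    rw [Ψ.norm_eq] at h1
    rw [← ENNReal.toReal_ofReal (integral_nonneg fun X => sq_nonneg ‖Ψ.ψ X‖), ← h1,
      ENNReal.toReal_one]
  have hL3 : ((L ^ 3) ^ N : ℝ) ≠ 0 := by positivity
  rw [hM, mul_one, inv_pow, mul_inv_cancel₀ hL3] at hP
  exact hP

/-- **The translation correlation of a trial state in momentum space**:
`Re ∫_{cell^N} conj Ψ(X with xᵢ ↦ xᵢ + y) Ψ(X) dX = ∑ₙ L^{3N}|ĉₙ(Ψ)|² cos(2π n(i,·)·y/L)`. -/
theorem hasSum_translationCorrelation (hL : 0 < L) (Ψ : PeriodicTrialState N L) (i : Fin N)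
    (y : Space) :
    HasSum (fun n : Fin N × Fin 3 → ℤ => (L ^ 3) ^ N * ‖configFourierCoeff L Ψ.ψ n‖ ^ 2 *
        Real.cos (∑ k, 2 * Real.pi * (n (i, k) : ℝ) * y k / L))
      (∫ X in cellN N L, conj (Ψ.ψ (Function.update X i (X i + y))) * Ψ.ψ X).re :=
  hasSum_correlation hL Ψ.contDiff.continuous Ψ.periodic i y

/-- `|ĉₙ(∂_{i,k}Ψ)|² = (2π n(i,k)/L)² |ĉₙ(Ψ)|²` (real form of the derivative rule). -/
theorem norm_sq_configFourierCoeff_fderiv (hL : 0 < L) (Ψ : PeriodicTrialState N L)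
    (n : Fin N × Fin 3 → ℤ) (i : Fin N) (k : Fin 3) :
    ‖configFourierCoeff L (fun X => fderiv ℝ Ψ.ψ X (Pi.single i (EuclideanSpace.single k 1))) n‖ ^ 2
      = (2 * Real.pi * (n (i, k) : ℝ) / L) ^ 2 * ‖configFourierCoeff L Ψ.ψ n‖ ^ 2 := by
  rw [configFourierCoeff_fderiv hL Ψ.contDiff Ψ.periodic n i k, norm_mul, mul_pow]
  congr 1
  have : (2 * Real.pi * I * (n (i, k)) / L : ℂ) = ((2 * Real.pi * (n (i, k) : ℝ) / L : ℝ) : ℂ) * I := by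
    push_cast; ring
  rw [this, norm_mul, Complex.norm_I, mul_one, Complex.norm_real, Real.norm_eq_abs, sq_abs]

/-- **The gradient correlation of a trial state in momentum space**:
`Re ∑ₖ ∫_{cell^N} conj ∂_{i,k}Ψ(X with xᵢ ↦ xᵢ + y) ∂_{i,k}Ψ(X) dX =
∑ₙ L^{3N}|ĉₙ(Ψ)|² |2π n(i,·)/L|² cos(2π n(i,·)·y/L)`. -/
theorem hasSum_gradientCorrelation (hL : 0 < L) (Ψ : PeriodicTrialState N L) (i : Fin N)
    (y : Space) :
    HasSum (fun n : Fin N × Fin 3 → ℤ => (L ^ 3) ^ N * ‖configFourierCoeff L Ψ.ψ n‖ ^ 2 *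
        (∑ k, (2 * Real.pi * (n (i, k) : ℝ) / L) ^ 2) *
        Real.cos (∑ k, 2 * Real.pi * (n (i, k) : ℝ) * y k / L))
      (∑ k : Fin 3, ∫ X in cellN N L,
        conj (fderiv ℝ Ψ.ψ (Function.update X i (X i + y)) (Pi.single i (EuclideanSpace.single k (1 : ℝ)))) *
          fderiv ℝ Ψ.ψ X (Pi.single i (EuclideanSpace.single k (1 : ℝ)))).re := by
  -- each partial derivative is a continuous periodic function
  have hk : ∀ k : Fin 3, HasSum (fun n : Fin N × Fin 3 → ℤ => (L ^ 3) ^ N *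
      ‖configFourierCoeff L (fun X => fderiv ℝ Ψ.ψ X (Pi.single i (EuclideanSpace.single k 1))) n‖ ^ 2 *
        Real.cos (∑ k, 2 * Real.pi * (n (i, k) : ℝ) * y k / L))
      (∫ X in cellN N L,
        conj (fderiv ℝ Ψ.ψ (Function.update X i (X i + y)) (Pi.single i (EuclideanSpace.single k (1 : ℝ)))) *
          fderiv ℝ Ψ.ψ X (Pi.single i (EuclideanSpace.single k (1 : ℝ)))).re := by
    intro k
    have hper : IsTorusPeriodic L (fun X => fderiv ℝ Ψ.ψ X (Pi.single i (EuclideanSpace.single k 1))) := by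
      intro X j l
      have hf : (fun Y => Ψ.ψ (Y + Pi.single j (EuclideanSpace.single l L))) = Ψ.ψ :=
        funext fun Y => Ψ.periodic Y j l
      show fderiv ℝ Ψ.ψ (X + Pi.single j (EuclideanSpace.single l L)) _ = fderiv ℝ Ψ.ψ X _
      rw [← fderiv_comp_add_right, hf]
    exact hasSum_correlation hL (continuous_fderiv_config_single Ψ.contDiff i k) hper i y
  have hsum := hasSum_sum (s := (Finset.univ : Finset (Fin 3))) fun k _ => hk k
  rw [Complex.re_sum]
  refine hsum.congr_fun fun n => ?_
  simp_rw [norm_sq_configFourierCoeff_fderiv hL Ψ n i]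
  rw [Finset.mul_sum, Finset.sum_mul]
  refine Finset.sum_congr rfl fun k _ => ?_
  ring

end Summit.AtomisticToContinuum.BoseEinsteinCondensation.Theorems.CoreDeficitBounds

end
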